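import Summits.Langlands.Langlands.Theses.QuarterDeficit1951
import Summits.Langlands.Langlands.Theorems.QuarterDeficit1951CensusDeficit1951StubConjTransport
import Summits.Langlands.Langlands.Theorems.CensusDeficit1951.Negative.CensusDeficit1951FalseOfOddWindowCertificate
import Summits.Langlands.Langlands.Theorems.QuarterDeficit1951CensusDeficit1951Calibration

/-!
# Line `Sketch` — lead c1/c2 (2026-08-17): REFUTATION-FIRST skeleton for crux stmt-Langlands-17933
(lead c2, cycle 2: §1b adds the CALIBRATION stub `stub_calibration` — the `J = ∅` model, proved in
`Theorems/QuarterDeficit1951CensusDeficit1951Calibration.lean`; §1/§2 unchanged from lead c1.)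
`Summit.Langlands.Langlands.Theses.QuarterDeficit1951.CensusDeficit1951` (D)

The composition concludes `¬ CensusDeficit1951`. D is numerically FALSE for every order-5 `χ` (all four order-5 spaces of
level 1951 carry the fingerprinted odd `r = 0` newform — `Cruxes/QuarterFingerprintDeficit/SightingHejhalR0.md`, kit
j020406/7, j020748/9 — so every certifiable v1 transcript has `U ≥ 1 ∧ violates = false`, i.e. `certifiesDeficit = false`;
lead c0's TRUE-direction line `conjugate-pair-census` died at exactly this stub, `Lines/conjugate_pair_census_dead.md`).
In-kernel, `¬D` holds as soon as the kernel has, for ONE order-5 `χ`, one fingerprinted window Maass cusp form or two window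
cusp forms; neither is constructible in Mathlib today, so the decisive stub is a computation-class CONSTRUCTION hypothesis —
and it is the SAME one as the parent crux's (stmt-Langlands-15897, line `Sketch`, lead c2) decisive stub P4:
`OddWindowCertificate` (def landed p158019; CERTIFICATE-B / Milestone C in `Cruxes/QuarterFingerprintDeficit/`). It is SHARED
here, not duplicated: one Arb certificate closes both cruxes.

§1 is the refutation composition (sorry-free modulo the shared P4; glue = landed negative lemma p161038).
§2 is the proof-direction decomposition registered for the skeleton audit (c0's `conjugate-pair-census` pieces:
`stub_conjTransport` LANDED p158923, `stub_pairDeficit` EXPECTED FALSE = the refutation target in positive dress;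
`CensusDeficit1951_of` kernel-checked glue). The only `sorry`s are `stub_oddWindowCertificate` and `stub_pairDeficit`.
Alternative decisive stub (multiplicity mode, landed p161187 pending review): `TwoWindowMaassCuspFormsAt1951` /
neighbour sighting — two Laplace-only enclosures, no Hecke boxes; cheaper for D alone if a generic `|r| ≤ 1/10` neighbour
exists in some order-5 space (ideator-1 scan j025333–6).
-/

set_option linter.dupNamespace false

namespace Summit.Langlands.Langlands.Cruxes.CensusDeficit1951.LineSketch

open Literature.NumberTheory.Automorphic
open Summit.Langlands.Langlands.Theses.QuarterDeficit1951
open Summit.Langlands.Langlands.Theorems.QuarterFingerprintDeficit.Negative (OddWindowCertificate)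
open Summit.Langlands.Langlands.Theorems.CensusDeficit1951.Negative (CensusDeficit1951_false_of_OddWindowCertificate)

/-! ## 1. The decisive computational stub (SHARED with the parent crux's P4) and the refutation composition -/

/-- STUB (DECISIVE, computational — shared with stmt-Langlands-15897's P4; NOT a proving task): the odd-sector window
certificate at `(1951, χ)` — `OddWindowCertificate` is the LANDED def (p158019): an order-5 `χ`, an odd bounded `C²`
automorphic eigenfunction `u ≢ 0` with `|λ − 1/4| ≤ 1/100` and Hecke boxes `‖μ_p − a_p‖ ≤ r_p`, `a_p² χ̄(p) ∈ Φ`,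
`r_p (2‖a_p‖ + r_p) ≤ 1/100`, `p ≤ 13`. Not provable in-kernel without the spectral theory of `L²(Γ₀(N)\ℍ, χ)`; decided by
lead c2's Arb certificate (CERTIFICATE-B: Hejhal re-solve j025718 → exact ℤ[ζ₅] trial vector → point-pair quasimode in the
odd sector; Milestone C: Hecke boxes by the joint pigeonhole). [folklore] -/
theorem stub_oddWindowCertificate : OddWindowCertificate := by
  sorry

/-- COMPOSITION (sorry-free modulo the shared stub): the landed negative lemma `OddWindowCertificate → ¬ D` (p161038:
oddness ⇒ cusp clauses, dictionary ⇒ `IsMaassCuspFormOn`, boxes ⇒ windowed fingerprint, decoding theorem I contrapositive)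
applied to the stub — the conclusion is literally `¬ D`. [folklore] -/
theorem not_CensusDeficit1951 : ¬ CensusDeficit1951 :=
  CensusDeficit1951_false_of_OddWindowCertificate stub_oddWindowCertificate

/-! ## 1b. Calibration stub (lead c2): the `J = ∅` model — what ANY kernel refutation of D must construct -/

/-- STUB (CLOSED, p164134 — lead c2, `Theorems/QuarterDeficit1951CensusDeficit1951Calibration.lean`):
for ANY `χ mod 1951`, if every weight-0 Maass cusp form on `(Γ₀(1951), χ)` (census sense `IsMaassCuspFormOn`)
vanishes identically, then a certified DEFICIT transcript for `χ` exists (the conjunct of D at `χ`, no order-5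
hypothesis) — the EMPTY family is complete joint spectral data and an explicit toy BLS
transcript (window `1/100`, `fpPrimes = []`, `h = sinc⁴(r/2)` with PROVED window bounds `1/2 ≤ h ≤ 2`, zero trace
box, `U = 0`) is a certified deficit census. Contrapositive = the refutation debt: any kernel proof of `¬ D` constructs
a NONZERO Maass cusp form of level 1951 with order-5 nebentypus (none is constructible in Mathlib today). Registered so
the calibration file lands `--supports`; it is not used by `CensusDeficit1951_of`. [folklore] -/
theorem stub_calibration :
    ∀ χ : DirichletCharacter ℂ 1951,
      (∀ (u : UpperHalfPlane → ℂ) (lam : ℝ), IsMaassCuspFormOn 1951 χ u lam → u = 0) →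
      ∃ c : MaassHeckeTraceCensus, (1 / 100 : ℚ) ≤ c.window ∧ (1 / 100 : ℚ) ≤ c.fpTol ∧
        (∀ p ∈ c.fpPrimes, p ∈ ({2, 3, 5, 7, 11, 13} : Finset ℕ)) ∧
        CertifiedMaassHeckeTraceCensus 1951 χ c ∧ c.certifiesDeficit = true :=
  Summit.Langlands.Langlands.Theorems.CensusDeficit1951.stub_calibration

/-! ## 2. Proof-direction decomposition (registered for the skeleton audit; EXPECTED FALSE at `stub_pairDeficit`) -/

/-- STUB (CLOSED, p158923): conjugation transport of certified deficit transcripts `χ ↦ χ⁻¹`. [folklore] -/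
theorem stub_conjTransport :
    ∀ (N : ℕ) (χ : DirichletCharacter ℂ N) (c : MaassHeckeTraceCensus),
      CertifiedMaassHeckeTraceCensus N χ c → c.certifiesDeficit = true →
      ∃ c' : MaassHeckeTraceCensus, c'.window = c.window ∧ c'.fpTol = c.fpTol ∧
        c'.fpPrimes = c.fpPrimes ∧ CertifiedMaassHeckeTraceCensus N χ⁻¹ c' ∧
        c'.certifiesDeficit = true :=
  Summit.Langlands.Langlands.Theorems.CensusDeficit1951.stub_conjTransport

/-- STUB (EXPECTED FALSE — numerically false for every order-5 `χ₀`, see `Lines/conjugate_pair_census_dead.md`; kept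
only so that the audit sees a composition to the crux BY NAME): certified deficit transcripts for one order-5 `χ₀` and for
`χ₀²`. Verdict class computation. [folklore] -/
theorem stub_pairDeficit :
    ∃ χ₀ : DirichletCharacter ℂ 1951, orderOf χ₀ = 5 ∧
      (∃ c : MaassHeckeTraceCensus, (1 / 100 : ℚ) ≤ c.window ∧ (1 / 100 : ℚ) ≤ c.fpTol ∧
        (∀ p ∈ c.fpPrimes, p ∈ ({2, 3, 5, 7, 11, 13} : Finset ℕ)) ∧
        CertifiedMaassHeckeTraceCensus 1951 χ₀ c ∧ c.certifiesDeficit = true) ∧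
      (∃ c : MaassHeckeTraceCensus, (1 / 100 : ℚ) ≤ c.window ∧ (1 / 100 : ℚ) ≤ c.fpTol ∧
        (∀ p ∈ c.fpPrimes, p ∈ ({2, 3, 5, 7, 11, 13} : Finset ℕ)) ∧
        CertifiedMaassHeckeTraceCensus 1951 (χ₀ ^ 2) c ∧ c.certifiesDeficit = true) := by
  sorry

/-- Classification of the order-5 characters mod 1951: `χ ∈ {χ₀, χ₀², (χ₀²)⁻¹, χ₀⁻¹}` (cyclicity of `(ℤ/1951)ˣ`).
[folklore] -/
theorem eq_pow_of_orderOf_eq_five (χ χ₀ : DirichletCharacter ℂ 1951) (hχ₀ : orderOf χ₀ = 5)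
    (hχ : orderOf χ = 5) : χ = χ₀ ∨ χ = χ₀ ^ 2 ∨ χ = (χ₀ ^ 2)⁻¹ ∨ χ = χ₀⁻¹ := by
  -- c0 / strategist proof (Lines/conjugate_pair_census.lean), verbatim
  haveI : Fact (Nat.Prime 1951) := ⟨by norm_num⟩
  obtain ⟨g, hg⟩ := IsCyclic.exists_generator (α := (ZMod 1951)ˣ)
  have h5 : χ₀ ^ 5 = 1 := by rw [← hχ₀]; exact pow_orderOf_eq_one χ₀
  have hζ5 : (χ₀ g) ^ 5 = 1 := by
    rw [← MulChar.pow_apply_coe, h5, MulChar.one_apply_coe]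
  have hζ1 : χ₀ g ≠ 1 := by
    intro h1
    have hχ₀1 : χ₀ = 1 := by
      refine MulChar.ext fun a => ?_
      obtain ⟨m, rfl⟩ := Subgroup.mem_zpowers_iff.mp (hg a)
      have hu : MulChar.toUnitHom χ₀ g = 1 :=
        Units.ext (by rw [MulChar.coe_toUnitHom, Units.val_one]; exact h1)
      rw [MulChar.one_apply_coe, ← MulChar.coe_toUnitHom, map_zpow, hu, one_zpow, Units.val_one]
    rw [hχ₀1, orderOf_one] at hχ₀
    exact absurd hχ₀ (by norm_num)
  have hprim : IsPrimitiveRoot (χ₀ g) 5 := by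
    have hd : orderOf (χ₀ g) ∣ 5 := orderOf_dvd_of_pow_eq_one hζ5
    rcases (Nat.dvd_prime (by norm_num)).mp hd with h | h
    · exact absurd (orderOf_eq_one_iff.mp h) hζ1
    · exact IsPrimitiveRoot.iff_orderOf.mpr h
  have hξ5 : (χ g) ^ 5 = 1 := by
    rw [← MulChar.pow_apply_coe, ← hχ, pow_orderOf_eq_one, MulChar.one_apply_coe]
  obtain ⟨k, hk, hkζ⟩ := hprim.eq_pow_of_pow_eq_one hξ5
  have hχk : χ = χ₀ ^ k := by
    refine MulChar.ext fun a => ?_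
    obtain ⟨m, rfl⟩ := Subgroup.mem_zpowers_iff.mp (hg a)
    have e2 : MulChar.toUnitHom χ g = MulChar.toUnitHom (χ₀ ^ k) g :=
      Units.ext (by rw [MulChar.coe_toUnitHom, MulChar.coe_toUnitHom, MulChar.pow_apply_coe, hkζ])
    rw [← MulChar.coe_toUnitHom, ← MulChar.coe_toUnitHom, map_zpow, map_zpow, e2]
  interval_cases k
  · exfalso
    rw [pow_zero] at hχk
    rw [hχk, orderOf_one] at hχ
    exact absurd hχ (by norm_num)
  · left; rw [hχk, pow_one]
  · right; left; exact hχk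
  · right; right; left
    rw [hχk, eq_inv_iff_mul_eq_one, ← pow_add]
    exact h5
  · right; right; right
    rw [hχk, eq_inv_iff_mul_eq_one, ← pow_succ]
    exact h5

/-- PROOF-DIRECTION COMPOSITION (kernel-checked modulo `stub_pairDeficit`): transport + pair censuses give the crux BY
NAME (`k = 1, 2` from the pair; `k = 3, 4` by transport applied to `χ₀²`, `χ₀`). [folklore] -/
theorem CensusDeficit1951_of : CensusDeficit1951 := by
  intro χ hχ
  obtain ⟨χ₀, hχ₀, h1, h2⟩ := stub_pairDeficit
  have transport : ∀ ψ : DirichletCharacter ℂ 1951,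
      (∃ c : MaassHeckeTraceCensus, (1 / 100 : ℚ) ≤ c.window ∧ (1 / 100 : ℚ) ≤ c.fpTol ∧
        (∀ p ∈ c.fpPrimes, p ∈ ({2, 3, 5, 7, 11, 13} : Finset ℕ)) ∧
        CertifiedMaassHeckeTraceCensus 1951 ψ c ∧ c.certifiesDeficit = true) →
      (∃ c : MaassHeckeTraceCensus, (1 / 100 : ℚ) ≤ c.window ∧ (1 / 100 : ℚ) ≤ c.fpTol ∧
        (∀ p ∈ c.fpPrimes, p ∈ ({2, 3, 5, 7, 11, 13} : Finset ℕ)) ∧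
        CertifiedMaassHeckeTraceCensus 1951 ψ⁻¹ c ∧ c.certifiesDeficit = true) := by
    rintro ψ ⟨c, hw, ht, hp, hc, hv⟩
    obtain ⟨c', hw', ht', hp', hc', hv'⟩ := stub_conjTransport 1951 ψ c hc hv
    refine ⟨c', ?_, ?_, fun p hpp => hp p ?_, hc', hv'⟩
    · rw [hw']; exact hw
    · rw [ht']; exact ht
    · rw [← hp']; exact hpp
  rcases eq_pow_of_orderOf_eq_five χ χ₀ hχ₀ hχ with rfl | rfl | rfl | rfl
  · exact h1
  · exact h2
  · exact transport _ h2
  · exact transport _ h1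

end Summit.Langlands.Langlands.Cruxes.CensusDeficit1951.LineSketch
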